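import Summits.RiemannHypothesis.RiemannHypothesis.Theorems.SemilocalNegCertWide
import HarnessLib

/-!
# Semi-local thresholds, negative side (IVa): a polynomial majorant of the archimedean density `w` on FAR pieces `[T₀, T₁]`, `T₀ > 0`

Cell `rh-explicit` (HOME `run/shared/lean/pub/rh-explicit/`), seat cc-s2-4 gen8 (kernel column of the A4 SEMILOCAL-TABLE; first file of the
PIECEWISE-witness layer proposed in `HOME/cc-s2-4/CC4-LEAN.md` §13.6).  Honest framing: bookkeeping for negative certificates about the
tree's `weilSemilocalThreshold S`; nothing here bears on RH.  No data is trusted.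

The certificates `WeilNegCertP` / `checkMainW` bound the archimedean bulk `∫ w·D` through a majorant of `t·w(t)` and the factorisation
`D(t) = t·q(t)`, available because the increment `D` of a polynomial×indicator witness is ONE polynomial with `D(0) = 0`.  For a
PIECEWISE polynomial witness the increment is a polynomial `D_i` only on each `t`-piece `[T_i, T_{i+1}]`, with `D_i(0) ≠ 0` in general
for `i ≥ 1`; there one needs a majorant of `w` itself.  On a far piece (`T₀ > 0`) write `w(t) = (t·w(t))·(1/t)` and
`1/t = (1/T₀)·1/(1 + x)`, `x = (t − T₀)/T₀ ≥ 0`, `1/(1+x) ≤ A_{m'}(x)` (the alternating geometric majorant already used for the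
centred construction, `inv_one_add_le_geomAlt`):

* `invFarL m' T₀` — the list of `(1/T₀)·A_{m'}((t − T₀)/T₀) ≥ 1/t` on `[T₀, ∞)` (`inv_le_ev_invFarL`);
* `archMajorFarL n m K u₀ m' T₀ = archMajorWL n m K u₀ · invFarL m' T₀ ≥ w(t)` for `0 < T₀ ≤ t ≤ 8`, `u₀ ≤ u_K(t)`
  (`weilArchDensity_le_far`; `archMajorWL` is the wide centred majorant of `t·w`, `SemilocalNegCertWide.lean`);
* THEOREM B⁗ `setIntegral_weilArchDensity_mul_le_pieceFar`: for a list polynomial `D ≥ 0` agreeing with the increment on `(T₀, T₁]`,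
  `0 < T₀ < T₁ ≤ 8`: `∫_{(T₀,T₁]} w·D ≤ pieceFarQ n m K m' D T₀ T₁` (rational, kernel-computable; sharp when `T₁ ≤ 1.25·T₀` and the
  centred variable stays `≤ 0.25`).

Folklore throughout.
-/

set_option autoImplicit false
set_option linter.dupNamespace false  -- the mandated namespace repeats `RiemannHypothesis`

noncomputable section

open Complex Filter Set MeasureTheory Topology
open scoped Real

namespace Summit.RiemannHypothesis.RiemannHypothesis.Theorems.SemilocalPolyWitness

open MeasureTheory Set Finset Real
open Literature.NumberTheory.LFunctions
open Summit.RiemannHypothesis.RiemannHypothesis.Theorems.MotivicDoor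
open LQ

/-! ## A polynomial majorant of `1/t` on `[T₀, ∞)` -/

/-- The list of `(1/T₀)·A_{m'}((t − T₀)/T₀)`. -/
def invFarL (m' : ℕ) (T0 : ℚ) : List ℚ := smul (1 / T0) (geomL (2 * m' + 1) [-1, 1 / T0])

/-- Evaluation of `invFarL`. -/
theorem ev_invFarL (m' : ℕ) (T0 : ℚ) (t : ℝ) :
    ev (invFarL m' T0) t = 1 / (T0 : ℝ) * geomAlt m' (t / T0 - 1) := by
  rw [invFarL, ev_smul, ev_geomL, geomAlt]
  have e : ev [-1, 1 / T0] t = t / T0 - 1 := by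
    simp
    ring
  rw [e]
  push_cast
  ring

/-- **`1/t ≤ ev (invFarL m' T₀) t`** for `0 < T₀ ≤ t`. -/
theorem inv_le_ev_invFarL (m' : ℕ) {T0 : ℚ} (hT0 : 0 < T0) {t : ℝ} (ht : (T0 : ℝ) ≤ t) :
    1 / t ≤ ev (invFarL m' T0) t := by
  rw [ev_invFarL]
  have hT0' : (0 : ℝ) < T0 := by exact_mod_cast hT0
  have ht0 : 0 < t := lt_of_lt_of_le hT0' ht
  set x : ℝ := t / T0 - 1 with hx
  have hx0 : 0 ≤ x := by
    rw [hx, sub_nonneg, le_div_iff₀ hT0', one_mul]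
    exact ht
  have hTne : (T0 : ℝ) ≠ 0 := hT0'.ne'
  have h1x : 1 + x = t / T0 := by rw [hx]; ring
  have e : 1 / (T0 : ℝ) * (1 / (1 + x)) = 1 / t := by
    rw [h1x, one_div_div, ← mul_div_assoc, one_div_mul_cancel hTne]
  rw [← e]
  exact mul_le_mul_of_nonneg_left (inv_one_add_le_geomAlt m' hx0) (by positivity)

/-! ## The far majorant of `w` -/

/-- **The far majorant list** `archMajorFarL n m K u₀ m' T₀ = archMajorWL n m K u₀ · invFarL m' T₀`. -/
def archMajorFarL (n m K : ℕ) (u0 : ℚ) (m' : ℕ) (T0 : ℚ) : List ℚ :=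
  mul (archMajorWL n m K u0) (invFarL m' T0)

/-- **LEMMA A⁗ — far majorant of `w`**: for `0 < T₀ ≤ t ≤ 8`, `n ≥ 1`, a rational `0 ≤ u₀ ≤ u_K(t)`:
`w(t) ≤ ev (archMajorFarL n m K u₀ m' T₀) t`. -/
theorem weilArchDensity_le_far (n m K : ℕ) (hn : 0 < n) {u0 : ℚ} (hu0 : 0 ≤ u0) (m' : ℕ) {T0 : ℚ} (hT0 : 0 < T0)
    {t : ℝ} (ht0 : (T0 : ℝ) ≤ t) (ht8 : t ≤ 8) (hu : (u0 : ℝ) ≤ uSum K t) :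
    weilArchDensity t ≤ ev (archMajorFarL n m K u0 m' T0) t := by
  have hT0' : (0 : ℝ) < T0 := by exact_mod_cast hT0
  have htpos : 0 < t := lt_of_lt_of_le hT0' ht0
  rw [archMajorFarL, ev_mul]
  have h1 : t * weilArchDensity t ≤ ev (archMajorWL n m K u0) t :=
    mul_weilArchDensity_le_wide n m K hn hu0 htpos ht8 hu
  have h2 : 1 / t ≤ ev (invFarL m' T0) t := inv_le_ev_invFarL m' hT0 ht0
  have hM : 0 ≤ ev (archMajorWL n m K u0) t :=
    le_trans (mul_nonneg htpos.le (weilArchDensity_pos htpos).le) h1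
  have e : weilArchDensity t = (t * weilArchDensity t) * (1 / t) := by
    field_simp
  rw [e]
  exact mul_le_mul h1 h2 (by positivity) hM

/-! ## THEOREM B⁗: the bulk integral on a far piece `(T₀, T₁]` -/

/-- The rational far-piece bound: `[∫ archMajorFarL·D]_{T₀}^{T₁}` with the majorant centred at `u₀ = u_K(T₀)`. -/
def pieceFarQ (n m K m' : ℕ) (D : List ℚ) (T0 T1 : ℚ) : ℚ :=
  evQ (integ (mul (archMajorFarL n m K (evQ (uSumL K) T0) m' T0) D)) T1 -
    evQ (integ (mul (archMajorFarL n m K (evQ (uSumL K) T0) m' T0) D)) T0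

/-- **THEOREM B⁗.**  Let `0 < T₀ < T₁ ≤ 8` be rationals and let the increment `Dfun` agree on `(T₀, T₁]` with the list
polynomial `D`, non-negative there.  Then `w·Dfun` is integrable on `(T₀, T₁]` and `∫_{(T₀,T₁]} w·Dfun ≤ pieceFarQ n m K m' D T₀ T₁`. -/
theorem setIntegral_weilArchDensity_mul_le_pieceFar {D : List ℚ} {Dfun : ℝ → ℝ} {T0 T1 : ℚ} (hT0 : 0 < T0)
    (hT01 : T0 < T1) (hT8 : (T1 : ℝ) ≤ 8)
    (hD : ∀ t ∈ Ioc (T0 : ℝ) T1, Dfun t = ev D t) (hDnn : ∀ t ∈ Ioc (T0 : ℝ) T1, 0 ≤ ev D t)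
    (n m K m' : ℕ) (hn : 0 < n) :
    IntegrableOn (fun t ↦ weilArchDensity t * Dfun t) (Ioc (T0 : ℝ) T1) ∧
      ∫ t in Ioc (T0 : ℝ) T1, weilArchDensity t * Dfun t ≤ ((pieceFarQ n m K m' D T0 T1 : ℚ) : ℝ) := by
  have hT0' : (0 : ℝ) < T0 := by exact_mod_cast hT0
  have hT01' : (T0 : ℝ) < T1 := by exact_mod_cast hT01
  set u0 : ℚ := evQ (uSumL K) T0 with hu0def
  have hu0R : (u0 : ℝ) = uSum K T0 := by rw [hu0def, ← ev_ratCast, ev_uSumL]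
  have hu0 : 0 ≤ u0 := by
    have h := uSum_nonneg K hT0'.le
    rw [← hu0R] at h
    exact_mod_cast h
  set Mj : ℝ → ℝ := fun t ↦ ev (mul (archMajorFarL n m K u0 m' T0) D) t with hM
  set P : ℝ → ℝ := fun t ↦ weilArchDensity t * ev D t with hP
  have hMc : Continuous Mj := continuous_ev _
  have hMi : IntegrableOn Mj (Ioc (T0 : ℝ) T1) :=
    (hMc.integrableOn_Icc (a := (T0 : ℝ)) (b := (T1 : ℝ))).mono_set Ioc_subset_Icc_self
  have hEq : EqOn (fun t ↦ weilArchDensity t * Dfun t) P (Ioc (T0 : ℝ) T1) := fun t ht ↦ by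
    simp only [hP, hD t ht]
  have hpt : ∀ t ∈ Ioc (T0 : ℝ) T1, 0 ≤ P t ∧ P t ≤ Mj t := by
    intro t ht
    have ht0 : 0 < t := lt_trans hT0' ht.1
    have hw := weilArchDensity_pos ht0
    have hqt := hDnn t ht
    refine ⟨mul_nonneg hw.le hqt, ?_⟩
    rw [hM, hP]
    simp only
    rw [ev_mul]
    refine mul_le_mul_of_nonneg_right ?_ hqt
    refine weilArchDensity_le_far n m K hn hu0 m' hT0 ht.1.le (ht.2.trans hT8) ?_
    rw [hu0R]
    exact uSum_mono K hT0'.le ht.1.le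
  have hPm : AEStronglyMeasurable P (volume.restrict (Ioc (T0 : ℝ) T1)) := by
    have : Measurable P := by
      rw [hP]
      exact measurable_weilArchDensity.mul (continuous_ev D).measurable
    exact this.aestronglyMeasurable
  have hPint : IntegrableOn P (Ioc (T0 : ℝ) T1) := by
    refine Integrable.mono' hMi hPm ?_
    filter_upwards [ae_restrict_mem measurableSet_Ioc] with t ht
    rw [Real.norm_eq_abs, abs_of_nonneg (hpt t ht).1]
    exact (hpt t ht).2
  have hint : IntegrableOn (fun t ↦ weilArchDensity t * Dfun t) (Ioc (T0 : ℝ) T1) :=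
    hPint.congr_fun hEq.symm measurableSet_Ioc
  refine ⟨hint, ?_⟩
  calc ∫ t in Ioc (T0 : ℝ) T1, weilArchDensity t * Dfun t
      = ∫ t in Ioc (T0 : ℝ) T1, P t := setIntegral_congr_fun measurableSet_Ioc hEq
    _ ≤ ∫ t in Ioc (T0 : ℝ) T1, Mj t := setIntegral_mono_on hPint hMi measurableSet_Ioc fun t ht ↦ (hpt t ht).2
    _ = ∫ t in (T0 : ℝ)..T1, Mj t := (intervalIntegral.integral_of_le hT01'.le).symm
    _ = ((pieceFarQ n m K m' D T0 T1 : ℚ) : ℝ) := by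
        rw [hM, integral_ev, pieceFarQ, ev_ratCast, ev_ratCast]
        push_cast
        rfl


/-! ## Bookkeeping on increasing cut lists (used by the piecewise certificate) -/

/-- Every cut after `T` exceeds `T`. -/
theorem cutsOk_lt_getD : ∀ (T : ℚ) (l : List ℚ), cutsOk T l = true → ∀ j, j < l.length → T < l.getD j 0
  | _, [], _, j, hj => by simp at hj
  | T, a :: l, h, j, hj => by
      simp only [cutsOk, Bool.and_eq_true, decide_eq_true_eq] at h
      cases j with
      | zero => simpa using h.1
      | succ j =>
          simp only [List.getD_cons_succ]
          exact h.1.trans (cutsOk_lt_getD a l h.2 j (by simpa using hj))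

/-- Every cut is at most the last cut. -/
theorem cutsOk_getD_le_lastCut : ∀ (T : ℚ) (l : List ℚ), cutsOk T l = true → ∀ j, j < l.length → l.getD j 0 ≤ lastCut T l
  | _, [], _, j, hj => by simp at hj
  | T, a :: l, h, j, hj => by
      simp only [cutsOk, Bool.and_eq_true, decide_eq_true_eq] at h
      simp only [lastCut]
      cases j with
      | zero => simpa using le_lastCut a l h.2
      | succ j => simp only [List.getD_cons_succ]; exact cutsOk_getD_le_lastCut a l h.2 j (by simpa using hj)

/-- Consecutive cuts increase: `(T :: l)[j] < l[j]`. -/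
theorem cutsOk_cons_getD_lt : ∀ (T : ℚ) (l : List ℚ), cutsOk T l = true → ∀ j, j < l.length → (T :: l).getD j 0 < l.getD j 0
  | _, [], _, j, hj => by simp at hj
  | T, a :: l, h, j, hj => by
      simp only [cutsOk, Bool.and_eq_true, decide_eq_true_eq] at h
      cases j with
      | zero => simpa using h.1
      | succ j => simp only [List.getD_cons_succ]; exact cutsOk_cons_getD_lt a l h.2 j (by simpa using hj)

/-! ## Kernel regression -/

/-- Sanity (kernel): on the piece `[1, 6/5]` the far majorant (`n = 10`, `m = 4`, `K = 5`, `m' = 4`, `u₀ = u_5(1)`) at `t = 11/10`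
lies in `(0.64884, 0.64886)` (`w(1.1) = 0.648843…`). -/
example :
    decide ((64884 : ℚ) / 100000 < evQ (archMajorFarL 10 4 5 (evQ (uSumL 5) 1) 4 1) (11 / 10)) = true ∧
      decide (evQ (archMajorFarL 10 4 5 (evQ (uSumL 5) 1) 4 1) (11 / 10) < (64886 : ℚ) / 100000) = true := by
  constructor <;> decide +kernel

end Summit.RiemannHypothesis.RiemannHypothesis.Theorems.SemilocalPolyWitness

end
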